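import Literature.Geometry.DiscreteGeometry.SphericalCodeHullVertexFanAngles
import Literature.Geometry.DiscreteGeometry.KissingFanCensus
import HarnessLib

/-!
# The node equation of the fan-refined hull triangulation of a spherical code

Topic `Literature/Geometry/DiscreteGeometry`.  Packaging of `SphericalCodeHullVertexAngles.lean`
(`Σ_{c ∈ facetsAt X y} facetAngleAt X c y = 2π`) and `SphericalCodeHullVertexFanAngles.lean`
(the facet angle at a vertex is the sum of the fan-triangle angles there) into the form used by
linear programs over the fan triangles: with the proof-free vertex wrapper `fVert` of
`KissingFanCensus.lean`,

* `fanAngleAt X c i y` — the angle AT `y` of the `i`-th fan triangle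
  `(fVert X c 0, fVert X c (i+1), fVert X c (i+2))` of the facet of `c` (in the argument order
  of `sphExcess`; `0` if `y` is not one of its three vertices);
* `sum_fanAngleAt_facet`: for `c ∈ facetsAt X y`, `Σ_{i < m_c − 2} fanAngleAt X c i y =
  facetAngleAt X c y`;
* **`sum_sum_fanAngleAt`** (the node equation): for `y ∈ X`,
  `Σ_{c ∈ facetsAt X y} Σ_{i < m_c − 2} fanAngleAt X c i y = 2π`;
* `fanAngleAt_add_eq_pi_add_sphExcess`: the three angles of a fan triangle at its vertices
  sum to `π + sphExcess` (Girard: the excess).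

Everything is PROVED; no named facts.

## References
* A.-M. Legendre, *Éléments de géométrie* (1794), VII.25. [folklore]
* T. C. Hales, arXiv:1209.6043 (2012), proof of Lemma 9 ("the angles around each node sum to
  `2π`"). [`Hales2012`]
-/

noncomputable section

namespace Literature.Geometry.DiscreteGeometry

open Real RealInnerProductSpace InnerProductGeometry Finset

local notation "E3" => EuclideanSpace ℝ (Fin 3)

section FanNodeSum

variable {X : Finset E3}

/-- **The angle at `y` of the `i`-th fan triangle of the facet of `c`**
(`(w 0, w (i+1), w (i+2))`, `w = fVert X c`), in the argument order of `sphExcess`: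
`∠(perpTo y w(i+1), perpTo y w(i+2))` at `y = w 0`, `∠(perpTo y w0, perpTo y w(i+2))` at
`y = w (i+1)`, `∠(perpTo y w0, perpTo y w(i+1))` at `y = w (i+2)`, and `0` otherwise.
[folklore] -/
def fanAngleAt (X : Finset E3) (c : E3) (i : ℕ) (y : E3) : ℝ :=
  if y = fVert X c 0 then angle (perpTo y (fVert X c (i + 1))) (perpTo y (fVert X c (i + 2)))
  else if y = fVert X c (i + 1) then angle (perpTo y (fVert X c 0)) (perpTo y (fVert X c (i + 2)))
  else if y = fVert X c (i + 2) then angle (perpTo y (fVert X c 0)) (perpTo y (fVert X c (i + 1)))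
  else 0

/-- `fanAngleAt` is nonnegative. [folklore] -/
theorem fanAngleAt_nonneg (X : Finset E3) (c : E3) (i : ℕ) (y : E3) : 0 ≤ fanAngleAt X c i y := by
  unfold fanAngleAt
  split_ifs
  · exact angle_nonneg _ _
  · exact angle_nonneg _ _
  · exact angle_nonneg _ _
  · exact le_rfl

/-- `fanAngleAt` is at most `π`. [folklore] -/
theorem fanAngleAt_le_pi (X : Finset E3) (c : E3) (i : ℕ) (y : E3) : fanAngleAt X c i y ≤ π := by
  unfold fanAngleAt
  split_ifs
  · exact angle_le_pi _ _
  · exact angle_le_pi _ _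
  · exact angle_le_pi _ _
  · exact pi_pos.le

/-- Distinct indices below `m` give distinct facet vertices (`fVert` spelling). [folklore] -/
theorem fVert_ne_of_ne (hX1 : ∀ y ∈ X, ‖y‖ = 1) {c : E3} (hc : c ∈ facetNormals X) {j k : ℕ}
    (hj : j < (tightSet X c).card) (hk : k < (tightSet X c).card) (hjk : j ≠ k) :
    fVert X c j ≠ fVert X c k := by
  have hc0 := ne_zero_of_mem_facetNormals hX1 hc
  rw [fVert_eq hc0, fVert_eq hc0]
  rw [← card_facetAngles hX1 hc0] at hj hk
  intro h
  exact hjk (facetVertex_injOn (X := X) hc0 (Finset.mem_coe.2 (Finset.mem_range.2 hj))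
    (Finset.mem_coe.2 (Finset.mem_range.2 hk)) h)

/-- **Per facet, the fan angles at a vertex add up to the facet angle there**: for
`c ∈ facetsAt X y`, `Σ_{i < m_c − 2} fanAngleAt X c i y = facetAngleAt X c y`. [folklore] -/
theorem sum_fanAngleAt_facet (hX1 : ∀ y ∈ X, ‖y‖ = 1)
    (h0 : (0 : E3) ∈ interior (convexHull ℝ (X : Set E3))) {y c : E3} (h : c ∈ facetsAt X y) :
    ∑ i ∈ range ((tightSet X c).card - 2), fanAngleAt X c i y = facetAngleAt X c y := by
  obtain ⟨hc, hyt⟩ := mem_facetsAt.1 h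
  have hc0 := ne_zero_of_mem_facetNormals hX1 hc
  set m := (tightSet X c).card with hm
  have hmf : (facetAngles X c hc0).card = m := card_facetAngles hX1 hc0
  have hm3 : 3 ≤ m := three_le_card_tightSet hc
  obtain ⟨j, hjm, hjy⟩ := exists_facetVertex_eq hX1 hc0 hyt
  rw [hmf] at hjm
  rw [← fVert_eq hc0] at hjy
  -- distinctness of the facet vertices
  have hne : ∀ {a b : ℕ}, a < m → b < m → a ≠ b → fVert X c a ≠ fVert X c b :=
    fun ha hb hab => fVert_ne_of_ne hX1 hc ha hb hab
  subst hjy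
  rcases Nat.eq_zero_or_pos j with rfl | hjpos
  · -- apex: every term is in the first branch
    rw [Finset.sum_congr rfl fun i hi => by
      rw [fanAngleAt, if_pos rfl]]
    have h := facetAngleAt_vertex_zero hX1 h0 hc
    rw [hmf] at h
    rw [fVert_eq hc0, h]
    refine Finset.sum_congr rfl fun i hi => ?_
    rw [fVert_eq hc0, fVert_eq hc0]
  · -- `j ≥ 1`: only the terms `i = j − 1` (second branch) and `i = j − 2` (third branch) survive
    have hterm : ∀ i ∈ range (m - 2), fanAngleAt X c i (fVert X c j) =
        (if i = j - 1 then angle (perpTo (fVert X c j) (fVert X c 0))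
            (perpTo (fVert X c j) (fVert X c (i + 2))) else 0) +
        (if i = j - 2 ∧ 2 ≤ j then angle (perpTo (fVert X c j) (fVert X c 0))
            (perpTo (fVert X c j) (fVert X c (i + 1))) else 0) := by
      intro i hi
      have him : i + 2 < m := by have := mem_range.1 hi; omega
      rw [fanAngleAt, if_neg (hne hjm (by omega) (by omega))]
      by_cases h1 : i = j - 1
      · have hji : fVert X c j = fVert X c (i + 1) := by rw [h1, Nat.sub_add_cancel hjpos]
        rw [if_pos hji, if_pos h1, if_neg (by omega), add_zero]
      · rw [if_neg (fun h' => h1 (by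
            by_contra hcon
            exact hne hjm (by omega) (by omega) h')), if_neg h1, zero_add]
        by_cases h2 : i = j - 2 ∧ 2 ≤ j
        · have hji : fVert X c j = fVert X c (i + 2) := by rw [h2.1, Nat.sub_add_cancel h2.2]
          rw [if_pos hji, if_pos h2]
        · rw [if_neg h2, if_neg]
          intro h'
          apply h2
          by_contra hcon
          exact hne hjm him (fun hh => hcon ⟨by omega, by omega⟩) h'
    rw [Finset.sum_congr rfl hterm, Finset.sum_add_distrib, Finset.sum_ite_eq', Finset.sum_ite]
    simp only [Finset.sum_const_zero, add_zero, mem_range]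
    rcases Nat.lt_or_ge j 2 with hj1 | hj2
    · -- `j = 1`
      obtain rfl : j = 1 := by omega
      have h := facetAngleAt_vertex_one hX1 h0 hc
      rw [fVert_eq hc0, h, if_pos (by omega)]
      rw [Finset.filter_false_of_mem (fun i _ => by omega), Finset.sum_empty, add_zero,
        fVert_eq hc0, fVert_eq hc0]
    · rcases Nat.lt_or_ge j (m - 1) with hjm1 | hjm1
      · -- middle vertex
        have h := facetAngleAt_vertex_mid hX1 h0 hc (j := j) hj2 (by rw [hmf]; omega)
        rw [fVert_eq hc0, h, if_pos (by omega)]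
        have hfilter : (range (m - 2)).filter (fun i => i = j - 2 ∧ 2 ≤ j) = {j - 2} := by
          ext i
          simp only [Finset.mem_filter, mem_range, Finset.mem_singleton]
          constructor
          · rintro ⟨_, hi, _⟩; exact hi
          · rintro rfl; exact ⟨by omega, rfl, hj2⟩
        rw [hfilter, Finset.sum_singleton, show j - 1 + 2 = j + 1 by omega,
          show j - 2 + 1 = j - 1 by omega, fVert_eq hc0, fVert_eq hc0, fVert_eq hc0, add_comm]
      · -- last vertex `j = m − 1`
        obtain rfl : j = m - 1 := by omega
        have h := facetAngleAt_vertex_last hX1 h0 hc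
        rw [hmf] at h
        rw [fVert_eq hc0, h, if_neg (by omega), zero_add]
        have hfilter : (range (m - 2)).filter (fun i => i = m - 1 - 2 ∧ 2 ≤ m - 1) = {m - 3} := by
          ext i
          simp only [Finset.mem_filter, mem_range, Finset.mem_singleton]
          constructor
          · rintro ⟨_, hi, _⟩; omega
          · rintro rfl; exact ⟨by omega, by omega, by omega⟩
        rw [hfilter, Finset.sum_singleton, show m - 3 + 1 = m - 2 by omega, fVert_eq hc0,
          fVert_eq hc0]

/-- **The node equation**: for `y ∈ X`, the angles at `y` of all fan triangles containing `y`
(over the facets containing `y`) sum to `2π`.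
[cite: Hales2012, proof of Lemma 9 ("the angles around each node sum to 2π")] -/
theorem sum_sum_fanAngleAt (hX1 : ∀ y ∈ X, ‖y‖ = 1)
    (h0 : (0 : E3) ∈ interior (convexHull ℝ (X : Set E3))) {y : E3} (hy : y ∈ X) :
    ∑ c ∈ facetsAt X y, ∑ i ∈ range ((tightSet X c).card - 2), fanAngleAt X c i y = 2 * π := by
  rw [Finset.sum_congr rfl fun c hc => sum_fanAngleAt_facet hX1 h0 hc]
  exact sum_facetAngleAt hX1 h0 hy

/-- **The three angles of a fan triangle sum to `π` plus its excess** (`Girard`): for a facet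
normal `c` and `i + 2 < m_c`, with `w = fVert X c`,
`fanAngleAt X c i (w 0) + fanAngleAt X c i (w (i+1)) + fanAngleAt X c i (w (i+2)) =
π + sphExcess (w 0) (w (i+1)) (w (i+2))`. [folklore] -/
theorem fanAngleAt_add_eq_pi_add_sphExcess (hX1 : ∀ y ∈ X, ‖y‖ = 1) {c : E3}
    (hc : c ∈ facetNormals X) {i : ℕ} (hi : i + 2 < (tightSet X c).card) :
    fanAngleAt X c i (fVert X c 0) + fanAngleAt X c i (fVert X c (i + 1)) +
        fanAngleAt X c i (fVert X c (i + 2)) =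
      π + sphExcess (fVert X c 0) (fVert X c (i + 1)) (fVert X c (i + 2)) := by
  have h01 : fVert X c (i + 1) ≠ fVert X c 0 := fVert_ne_of_ne hX1 hc (by omega) (by omega) (by omega)
  have h02 : fVert X c (i + 2) ≠ fVert X c 0 := fVert_ne_of_ne hX1 hc hi (by omega) (by omega)
  have h12 : fVert X c (i + 2) ≠ fVert X c (i + 1) := fVert_ne_of_ne hX1 hc hi (by omega) (by omega)
  have e0 : fanAngleAt X c i (fVert X c 0) =
      angle (perpTo (fVert X c 0) (fVert X c (i + 1))) (perpTo (fVert X c 0) (fVert X c (i + 2))) := by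
    rw [fanAngleAt, if_pos rfl]
  have e1 : fanAngleAt X c i (fVert X c (i + 1)) =
      angle (perpTo (fVert X c (i + 1)) (fVert X c 0)) (perpTo (fVert X c (i + 1)) (fVert X c (i + 2))) := by
    rw [fanAngleAt, if_neg h01, if_pos rfl]
  have e2 : fanAngleAt X c i (fVert X c (i + 2)) =
      angle (perpTo (fVert X c (i + 2)) (fVert X c 0)) (perpTo (fVert X c (i + 2)) (fVert X c (i + 1))) := by
    rw [fanAngleAt, if_neg h02, if_neg h12, if_pos rfl]
  rw [e0, e1, e2, sphExcess]
  ring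

end FanNodeSum

end Literature.Geometry.DiscreteGeometry

end
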